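import Summits.Ventures.PercRepro.C025ProfilePLDRankThree

/-!
# THE PARALLEL-EXTENSION INDUCTION: PER-LAYER DOMINANCE FOR EVERY MATROID WHOSE SIMPLIFICATION IS PAVING (night-3 g30)

`proofs/NIGHT3-G30-PAREXT.md` §3.  `pld_of_parallel_induction`: a class `P` of finite matroids closed under deleting one
element of a 2-circuit and under contracting the other, all of whose 2-circuit-free members satisfy PER-LAYER
DOMINANCE, consists of (PLD)-matroids — by induction on the number of elements through `PLDParExt.pld_of_parallel`.
THE INSTANCE: «every circuit has at most two elements or at least `rank` elements» (the simplification is paving, loops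
and parallel elements allowed).  The class survives deletion (`sp_delete`) and contraction by a non-loop
(`sp_contract`: a circuit `C` of `M ／ e` with `|C| ≥ 3` and `|C| < rank(M ／ e)` would make `C + e` a set of fewer than
`rank M` elements without loops or 2-circuits of `M`, hence independent, hence `C` independent in `M ／ e`), and its
2-circuit-free members are g28's paving-with-loops matroids.  Hence (PLD) — and, by the bridge, C-025 at every `(p, q)`
on every truncation of `M ⊕ free points` — for every finite matroid whose simplification is paving
(`pld_of_simplification_paving`, `rls_truncate_disjointSum_freeOn_of_simplification_paving`); every matroid of rank `≤ 3`
is an instance (`sp_of_eRank_le_three`).  No `def`, no `instance`, no notation.  Axioms: standard.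
-/

open scoped Matroid

namespace PercRepro

open Finset ThmH

namespace PLDParExt

variable {α : Type} [DecidableEq α]

/-- THE PARALLEL-EXTENSION INDUCTION PRINCIPLE: if a class `P` of finite matroids is closed under deleting one element
of a 2-circuit and under contracting the other (after the deletion), and every 2-circuit-free member of `P` satisfies
PER-LAYER DOMINANCE, then every finite member of `P` does. -/
theorem pld_of_parallel_induction (P : Matroid α → Prop)
    (hdel : ∀ (M : Matroid α) [M.Finite], P M → ∀ e e' : α, e ≠ e' → M.IsCircuit {e, e'} → P (M ＼ {e'}))
    (hcon : ∀ (M : Matroid α) [M.Finite], P M → ∀ e e' : α, e ≠ e' → M.IsCircuit {e, e'} →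
      P ((M ＼ {e'}) ／ {e}))
    (hbase : ∀ (M : Matroid α) [M.Finite], P M → (¬ ∃ e e' : α, e ≠ e' ∧ M.IsCircuit {e, e'}) →
      ∀ lo hi δ Θ : ℕ, Θ ≤ lo + hi + δ → (lo = 0 ∨ lo + hi + δ ≤ Θ) →
      (∑ I ∈ (gr M).powerset, (if lo ≤ (M.eRk (I : Set α)).toNat ∧ (M.eRk (I : Set α)).toNat ≤ hi ∧
          Θ ≤ (M.eRk ((gr M \ I : Finset α) : Set α)).toNat + (M.eRk (I : Set α)).toNat then
          ((M.eRk ((gr M \ I : Finset α) : Set α)).toNat).choose δ else 0)) ≤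
        ∑ I ∈ (gr M).powerset, (if lo + δ ≤ (M.eRk ((gr M \ I : Finset α) : Set α)).toNat ∧
          (M.eRk ((gr M \ I : Finset α) : Set α)).toNat ≤ hi + δ then
          ((M.eRk ((gr M \ I : Finset α) : Set α)).toNat).choose δ else 0))
    (M : Matroid α) [M.Finite] (hM : P M) :
    ∀ lo hi δ Θ : ℕ, Θ ≤ lo + hi + δ → (lo = 0 ∨ lo + hi + δ ≤ Θ) →
      (∑ I ∈ (gr M).powerset, (if lo ≤ (M.eRk (I : Set α)).toNat ∧ (M.eRk (I : Set α)).toNat ≤ hi ∧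
          Θ ≤ (M.eRk ((gr M \ I : Finset α) : Set α)).toNat + (M.eRk (I : Set α)).toNat then
          ((M.eRk ((gr M \ I : Finset α) : Set α)).toNat).choose δ else 0)) ≤
        ∑ I ∈ (gr M).powerset, (if lo + δ ≤ (M.eRk ((gr M \ I : Finset α) : Set α)).toNat ∧
          (M.eRk ((gr M \ I : Finset α) : Set α)).toNat ≤ hi + δ then
          ((M.eRk ((gr M \ I : Finset α) : Set α)).toNat).choose δ else 0) := by
  suffices H : ∀ n : ℕ, ∀ (M : Matroid α) [M.Finite], (gr M).card = n → P M →
      ∀ lo hi δ Θ : ℕ, Θ ≤ lo + hi + δ → (lo = 0 ∨ lo + hi + δ ≤ Θ) →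
      (∑ I ∈ (gr M).powerset, (if lo ≤ (M.eRk (I : Set α)).toNat ∧ (M.eRk (I : Set α)).toNat ≤ hi ∧
          Θ ≤ (M.eRk ((gr M \ I : Finset α) : Set α)).toNat + (M.eRk (I : Set α)).toNat then
          ((M.eRk ((gr M \ I : Finset α) : Set α)).toNat).choose δ else 0)) ≤
        ∑ I ∈ (gr M).powerset, (if lo + δ ≤ (M.eRk ((gr M \ I : Finset α) : Set α)).toNat ∧
          (M.eRk ((gr M \ I : Finset α) : Set α)).toNat ≤ hi + δ then
          ((M.eRk ((gr M \ I : Finset α) : Set α)).toNat).choose δ else 0) from H _ M rfl hM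
  intro n
  induction n using Nat.strong_induction_on with
  | _ n ih =>
  intro M _ hn hM
  by_cases hex : ∃ e e' : α, e ≠ e' ∧ M.IsCircuit {e, e'}
  · obtain ⟨e, e', hne, hC⟩ := hex
    obtain ⟨he, he', hcl, hcl'⟩ := parallel_of_isCircuit_pair M hne hC
    have heM : e ∈ gr M := by rw [← Finset.mem_coe, coe_gr]; exact he.mem_ground
    have he'M : e' ∈ gr M := by rw [← Finset.mem_coe, coe_gr]; exact he'.mem_ground
    have hcardN : (gr (M ＼ {e'})).card < n := by
      rw [gr_delete_singleton, ← hn]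
      exact Finset.card_erase_lt_of_mem he'M
    have hcardC : (gr ((M ＼ {e'}) ／ {e})).card < n := by
      rw [gr_delete_contract, ← hn]
      exact lt_of_lt_of_le (Finset.card_erase_lt_of_mem (Finset.mem_erase.2 ⟨hne, heM⟩)) (Finset.card_erase_le)
    exact pld_of_parallel M hne he he' hcl hcl' (ih _ hcardN (M ＼ {e'}) rfl (hdel M hM e e' hne hC))
      (ih _ hcardC ((M ＼ {e'}) ／ {e}) rfl (hcon M hM e e' hne hC))
  · exact hbase M hM hex

omit [DecidableEq α] in
/-- «Every circuit has `≤ 2` or `≥ rank` elements» survives deletion. -/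
theorem sp_delete (M : Matroid α) (hsp : ∀ C, M.IsCircuit C → C.encard ≤ 2 ∨ M.eRank ≤ C.encard) (D : Set α) :
    ∀ C, (M ＼ D).IsCircuit C → C.encard ≤ 2 ∨ (M ＼ D).eRank ≤ C.encard := by
  intro C hC
  rcases hsp C (Matroid.delete_isCircuit_iff.1 hC).1 with h | h
  · exact Or.inl h
  · exact Or.inr ((eRank_delete_le M D).trans h)

omit [DecidableEq α] in
/-- Under «every circuit has `≤ 2` or `≥ rank` elements», a set of fewer than `rank` elements without loops and without
2-circuits is independent. -/
theorem indep_of_sp (M : Matroid α) [M.Finite] (hsp : ∀ C, M.IsCircuit C → C.encard ≤ 2 ∨ M.eRank ≤ C.encard)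
    (X : Set α) (hXE : X ⊆ M.E) (hX : X.encard < M.eRank) (hloop : ∀ x ∈ X, M.IsNonloop x)
    (hpair : ∀ x ∈ X, ∀ y ∈ X, x ≠ y → ¬ M.IsCircuit {x, y}) : M.Indep X := by
  by_contra hind
  obtain ⟨C', hC'X, hC'⟩ := ((M.not_indep_iff hXE).1 hind).exists_isCircuit_subset
  rcases hsp C' hC' with h | h
  · have hfin : C'.Finite := M.ground_finite.subset hC'.subset_ground
    have hn : C'.ncard ≤ 2 := by
      rw [← hfin.cast_ncard_eq] at h
      exact_mod_cast h
    interval_cases hk : C'.ncard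
    · exact hC'.nonempty.ne_empty ((Set.ncard_eq_zero hfin).1 hk)
    · obtain ⟨x, rfl⟩ := Set.ncard_eq_one.1 hk
      exact hC'.not_indep (Matroid.indep_singleton.2 (hloop x (hC'X (Set.mem_singleton x))))
    · obtain ⟨x, y, hxy, rfl⟩ := Set.ncard_eq_two.1 hk
      exact hpair x (hC'X (Set.mem_insert x {y})) y (hC'X (Set.mem_insert_of_mem x (Set.mem_singleton y)))
        hxy hC'
  · exact absurd (lt_of_le_of_lt (Set.encard_le_encard hC'X) hX) (not_lt.2 h)

omit [DecidableEq α] in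
/-- A circuit with more than two elements contains no loop and no 2-circuit of its own matroid. -/
theorem isNonloop_of_mem_isCircuit (M : Matroid α) {C : Set α} (hC : M.IsCircuit C) (h2 : 2 < C.encard) {x : α}
    (hx : x ∈ C) : M.IsNonloop x := by
  refine Matroid.indep_singleton.1 (hC.ssubset_indep (Set.ssubset_iff_subset_ne.2 ⟨Set.singleton_subset_iff.2 hx, ?_⟩))
  intro h
  rw [← h, Set.encard_singleton] at h2
  exact absurd h2 (by norm_num)

omit [DecidableEq α] in
/-- «Every circuit has `≤ 2` or `≥ rank` elements» survives contraction by a non-loop. -/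
theorem sp_contract (M : Matroid α) [M.Finite] (hsp : ∀ C, M.IsCircuit C → C.encard ≤ 2 ∨ M.eRank ≤ C.encard)
    {e : α} (he : M.IsNonloop e) :
    ∀ C, (M ／ {e}).IsCircuit C → C.encard ≤ 2 ∨ (M ／ {e}).eRank ≤ C.encard := by
  intro C hC
  by_contra hcon
  push Not at hcon
  obtain ⟨h2, hlt⟩ := hcon
  have hCE' : C ⊆ M.E \ {e} := by rw [← Matroid.contract_ground]; exact hC.subset_ground
  have heC : e ∉ C := fun h => (hCE' h).2 rfl
  have hCE : C ⊆ M.E := fun x hx => (hCE' hx).1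
  have hfin : C.Finite := M.ground_finite.subset hCE
  -- `C + e` has fewer than `rank M` elements
  have hsize : (insert e C).encard < M.eRank := by
    rw [Set.encard_insert_of_notMem heC, ← eRank_contract_singleton_add_one M he]
    haveI : (M ／ {e}).Finite := Matroid.contract_finite
    rw [ENat.lt_add_one_iff ((Matroid.eRank_ne_top_iff _).2 inferInstance)]
    exact (ENat.add_one_le_iff hfin.encard_lt_top.ne).2 hlt
  -- `C + e` has no loop of `M`
  have hnl : ∀ x ∈ C, (M ／ {e}).IsNonloop x := fun x hx => isNonloop_of_mem_isCircuit _ hC h2 hx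
  have hloop : ∀ x ∈ insert e C, M.IsNonloop x := by
    intro x hx
    rcases Set.mem_insert_iff.1 hx with rfl | hx
    · exact he
    · exact (hnl x hx).of_contract
  -- `C + e` has no 2-circuit of `M`
  have hpair : ∀ x ∈ insert e C, ∀ y ∈ insert e C, x ≠ y → ¬ M.IsCircuit {x, y} := by
    intro x hx y hy hxy hxy'
    obtain ⟨-, -, hyx, hxy''⟩ := parallel_of_isCircuit_pair M hxy hxy'
    rcases Set.mem_insert_iff.1 hx with hxe | hxC
    · -- `x = e`: `y ∥ e` makes `y` a loop of `M ／ e`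
      have hyC : y ∈ C := (Set.mem_insert_iff.1 hy).resolve_left (fun h => hxy (hxe.trans h.symm))
      rw [hxe] at hyx
      exact (hnl y hyC).not_isLoop (Matroid.contract_isLoop_iff_mem_closure.2
        ⟨hyx, fun h => heC ((Set.mem_singleton_iff.1 h) ▸ hyC)⟩)
    rcases Set.mem_insert_iff.1 hy with hye | hyC
    · -- `y = e`: `x ∥ e` makes `x` a loop of `M ／ e`
      rw [hye] at hxy''
      exact (hnl x hxC).not_isLoop (Matroid.contract_isLoop_iff_mem_closure.2
        ⟨hxy'', fun h => heC ((Set.mem_singleton_iff.1 h) ▸ hxC)⟩)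
    -- `x, y ∈ C` parallel in `M` are parallel in `M ／ e`, but `{x, y} ⊊ C` is independent there
    have hsub : ({x, y} : Set α) ⊂ C := by
      refine Set.ssubset_iff_subset_ne.2 ⟨?_, ?_⟩
      · exact Set.insert_subset hxC (Set.singleton_subset_iff.2 hyC)
      · intro h
        rw [← h, Set.encard_pair hxy] at h2
        exact absurd h2 (lt_irrefl _)
    have hind := hC.ssubset_indep hsub
    have hxcl : x ∈ (M ／ {e}).closure ({x, y} \ {x}) := by
      rw [Set.pair_sdiff_left hxy, Matroid.contract_closure_eq]
      refine ⟨M.closure_mono Set.subset_union_left hxy'', ?_⟩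
      intro h
      exact heC ((Set.mem_singleton_iff.1 h) ▸ hxC)
    exact hind.notMem_closure_sdiff_of_mem (Set.mem_insert x {y}) hxcl
  have hind : M.Indep (insert e C) := indep_of_sp M hsp _ (Set.insert_subset he.mem_ground hCE) hsize hloop hpair
  exact hC.not_indep ((he.contractElem_indep_iff).2 ⟨heC, hind⟩)

omit [DecidableEq α] in
/-- Without 2-circuits, «every circuit has `≤ 2` or `≥ rank` elements» is g28's paving-with-loops hypothesis. -/
theorem paving_loops_of_sp (M : Matroid α) [M.Finite] (hsp : ∀ C, M.IsCircuit C → C.encard ≤ 2 ∨ M.eRank ≤ C.encard)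
    (hex : ¬ ∃ e e' : α, e ≠ e' ∧ M.IsCircuit {e, e'}) :
    ∀ C, M.IsCircuit C → C.encard = 1 ∨ M.eRank ≤ C.encard := by
  intro C hC
  push Not at hex
  rcases hsp C hC with h | h
  · have hfin : C.Finite := M.ground_finite.subset hC.subset_ground
    have hn : C.ncard ≤ 2 := by
      rw [← hfin.cast_ncard_eq] at h
      exact_mod_cast h
    rw [← hfin.cast_ncard_eq]
    interval_cases hk : C.ncard
    · exact absurd ((Set.ncard_eq_zero hfin).1 hk) hC.nonempty.ne_empty
    · left; rfl
    · obtain ⟨x, y, hxy, rfl⟩ := Set.ncard_eq_two.1 hk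
      exact absurd hC (hex x y hxy)
  · exact Or.inr h

/-- PER-LAYER DOMINANCE FOR EVERY FINITE MATROID WHOSE SIMPLIFICATION IS PAVING («every circuit has at most two or at
least `rank` elements»), in the hPLD binder of `PLDBridge.rls_disjointSum_freeOn_of_pld`. -/
theorem pld_of_simplification_paving (M : Matroid α) [M.Finite]
    (hsp : ∀ C, M.IsCircuit C → C.encard ≤ 2 ∨ M.eRank ≤ C.encard) :
    ∀ lo hi δ Θ : ℕ, Θ ≤ lo + hi + δ → (lo = 0 ∨ lo + hi + δ ≤ Θ) →
      (∑ I ∈ (gr M).powerset, (if lo ≤ (M.eRk (I : Set α)).toNat ∧ (M.eRk (I : Set α)).toNat ≤ hi ∧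
          Θ ≤ (M.eRk ((gr M \ I : Finset α) : Set α)).toNat + (M.eRk (I : Set α)).toNat then
          ((M.eRk ((gr M \ I : Finset α) : Set α)).toNat).choose δ else 0)) ≤
        ∑ I ∈ (gr M).powerset, (if lo + δ ≤ (M.eRk ((gr M \ I : Finset α) : Set α)).toNat ∧
          (M.eRk ((gr M \ I : Finset α) : Set α)).toNat ≤ hi + δ then
          ((M.eRk ((gr M \ I : Finset α) : Set α)).toNat).choose δ else 0) :=
  pld_of_parallel_induction (fun M => ∀ C, M.IsCircuit C → C.encard ≤ 2 ∨ M.eRank ≤ C.encard)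
    (fun M _ h e e' _ _ => sp_delete M h {e'})
    (fun M _ h e e' hne hC => sp_contract (M ＼ {e'}) (sp_delete M h {e'})
      (Matroid.delete_isNonloop_iff.2 ⟨(parallel_of_isCircuit_pair M hne hC).1, by simpa using hne⟩))
    (fun M _ h hex => PavingPLD.pld_of_paving_loops M (paving_loops_of_sp M h hex)) M hsp

omit [DecidableEq α] in
/-- Every matroid of rank `≤ 3` has its simplification paving. -/
theorem sp_of_eRank_le_three (M : Matroid α) [M.Finite] (h3 : M.eRank ≤ 3) :
    ∀ C, M.IsCircuit C → C.encard ≤ 2 ∨ M.eRank ≤ C.encard := by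
  intro C hC
  rcases le_or_gt C.encard 2 with h | h
  · exact Or.inl h
  · right
    have hfin : C.Finite := M.ground_finite.subset hC.subset_ground
    rw [← hfin.cast_ncard_eq] at h ⊢
    have : 3 ≤ C.ncard := by exact_mod_cast h
    exact h3.trans (by exact_mod_cast this)

/-- C-025 AT EVERY `(p, q)` ON EVERY TRUNCATION OF «M ⊕ FREE POINTS» for every finite matroid `M` whose simplification
is paving. -/
theorem rls_truncate_disjointSum_freeOn_of_simplification_paving (M : Matroid α) [M.Finite]
    (hsp : ∀ C, M.IsCircuit C → C.encard ≤ 2 ∨ M.eRank ≤ C.encard)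
    (E₃ : Finset α) (h : Disjoint M.E (E₃ : Set α)) (r p q : ℕ) :
    haveI := PLDBridge.disjointSum_freeOn_finite M E₃ h
    ThmN.RLS (PercRepro.Matroid.truncate (M.disjointSum (Matroid.freeOn (E₃ : Set α)) h) r) p q :=
  PLDBridge.rls_disjointSum_freeOn_of_pld M E₃ h r p q (pld_of_simplification_paving M hsp)

end PLDParExt

end PercRepro
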